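import Summits.RiemannHypothesis.RiemannHypothesis.Theorems.WeilFormatCTailOddJMS
import Summits.RiemannHypothesis.RiemannHypothesis.Theorems.WeilFormatCMiddleEvenJ
import Summits.RiemannHypothesis.RiemannHypothesis.Theorems.WeilFormatCTailJJMatrixAlgebra
import HarnessLib

/-!
# Format C (odd sector): the COMPRESSED EXACT MIDDLE — design "MJ"

Route context: Fourier–Galerkin / Schur-complement certificates of Weil positivity on a window ("format C";
cell memo `run/shared/lean/pub/rh-explicit/rh-explicit-weil-10/FORMATC-DESIGN.md` §9.10; supporting
stmt-RiemannHypothesis-0098; seat rh-explicit-weil-10).  Between the exact columns `[B, B₃)` (`B₃ ≥ 2B`) and the analytic tail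
the structured column decomposition of `WeilFormatCColumnKernel` / `abs_oddKernel_col_sub_families_le` is EXACT up to the
order-`J` remainder; summing `(b_m·x)²/w_m` over a FINITE middle range `[B₃, B₄)` with per-mode weights `0 < w_m ≤ d_m` therefore
needs no estimate beyond ONE Peter–Paul step: the structured part is the quadratic form of the `(2J)×(2J)` Gram of the EXACT mode
values `(F_m/π)m^{-e^A_j}`, `m^{-e^B_r}` (four `J×J` blocks, finite sums the data seat encloses from the light table), the
remainder a diagonal.  Kernel cost per middle column: `(2J)²` products instead of `B²/2` — the production lever for the odd parity
(PRODUCTION-TABLE-v2.md §3).  The conclusion is literally the `hUmid` premise of `weilPositivityOn_of_formatC_pieces`.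

* `odd_middleJ_majorant_matrix`.

Standard axioms; no definitions; no RH claim.
-/

set_option autoImplicit false
-- `Summit.RiemannHypothesis.RiemannHypothesis.…` is the layout-mandated namespace (summit = problem name).
set_option linter.dupNamespace false

noncomputable section

open Complex Finset Matrix
open scoped Real BigOperators ArithmeticFunction.vonMangoldt

namespace Summit.RiemannHypothesis.RiemannHypothesis.Theorems.WeilFormatC

open Literature.NumberTheory.LFunctions Literature.NumberTheory.LFunctions.Yoshida1992
open Literature.Analysis.SpecialFunctions

variable {a : ℝ}

/-! ## The middle majorant -/

section Middle

/-- **Odd-sector compressed exact middle** — see the module docstring. -/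
theorem odd_middleJ_majorant_matrix (ha : 0 < a) {B B₃ B₄ : ℕ} (hB : 1 ≤ B) (hBB : 2 * B ≤ B₃) (J : ℕ)
    (d w : ℕ → ℝ) (hw : ∀ l, B₃ ≤ l → l < B₄ → 0 < w l ∧ w l ≤ d l) {θ : ℝ} (hθ : 0 < θ) (x : Fin B → ℝ) :
    ∑ l ∈ Finset.Ico B₃ B₄, (∑ k : Fin B,
        ((gramCoeff a (((k : ℕ) : ℤ) + 1) ((l : ℤ) + 1) - gramCoeff a (((k : ℕ) : ℤ) + 1) (-((l : ℤ) + 1))) / 2) * x k) ^ 2 / d l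
      ≤ x ⬝ᵥ (Matrix.of fun k k' : Fin B ↦
          (1 + θ) * (((∑ j : Fin J, ∑ j' : Fin J, (∑ l ∈ Finset.Ico B₃ B₄, (((Complex.digamma (1 / 4 + ((freq a ((l : ℤ) + 1) : ℝ) : ℂ) / 2 * I)).im / 2 + (∑ k ∈ weilPrimeIndex a, (Λ k : ℝ) / Real.sqrt k * Real.sin (freq a ((l : ℤ) + 1) * Real.log k)) - archExpSumSin a ((l : ℤ) + 1)) / π / ((l : ℝ) + 1) ^ (2 * (j : ℕ) + 2)) * (((Complex.digamma (1 / 4 + ((freq a ((l : ℤ) + 1) : ℝ) : ℂ) / 2 * I)).im / 2 + (∑ k ∈ weilPrimeIndex a, (Λ k : ℝ) / Real.sqrt k * Real.sin (freq a ((l : ℤ) + 1) * Real.log k)) - archExpSumSin a ((l : ℤ) + 1)) / π / ((l : ℝ) + 1) ^ (2 * (j' : ℕ) + 2)) / w l) * ((-1 : ℝ) ^ ((k : ℕ) + 1) * (((k : ℕ) : ℝ) + 1) ^ (2 * (j : ℕ) + 1)) * ((-1 : ℝ) ^ ((k' : ℕ) + 1) * (((k' : ℕ) : ℝ) + 1)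 ^ (2 * (j' : ℕ) + 1)))
            + ∑ j : Fin J, ∑ r' : Fin J, (∑ l ∈ Finset.Ico B₃ B₄, (((Complex.digamma (1 / 4 + ((freq a ((l : ℤ) + 1) : ℝ) : ℂ) / 2 * I)).im / 2 + (∑ k ∈ weilPrimeIndex a, (Λ k : ℝ) / Real.sqrt k * Real.sin (freq a ((l : ℤ) + 1) * Real.log k)) - archExpSumSin a ((l : ℤ) + 1)) / π / ((l : ℝ) + 1) ^ (2 * (j : ℕ) + 2)) * (1 / ((l : ℝ) + 1) ^ (2 * (r' : ℕ) + 1)) / w l) * ((-1 : ℝ) ^ ((k : ℕ) + 1) * (((k : ℕ) : ℝ) + 1) ^ (2 * (j : ℕ) + 1)) * ((-1 : ℝ) ^ ((k' : ℕ) + 1) * (-((((k' : ℕ) : ℝ) + 1) ^ (2 * (r' : ℕ))) * ((Complex.digamma (1 / 4 + ((freq a (((k' : ℕ) : ℤ) + 1) : ℝ) : ℂ) / 2 * I)).im / 2 + (∑ p ∈ weilPrimeIndex a, (Λ p : ℝ) / Real.sqrt p * Real.sin (freq a (((k' : ℕ) : ℤ) + 1) * Real.log p)) - archExpSumSin a (((k'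 : ℕ) : ℤ) + 1)) / π - 4 * (Real.exp (a / 2) - Real.exp (-(a / 2))) ^ 2 / π * (-1 : ℝ) ^ (r' : ℕ) * (a ^ 2 / (4 * π ^ 2)) ^ (r' : ℕ) * (freq a (((k' : ℕ) : ℤ) + 1) / (1 + 4 * freq a (((k' : ℕ) : ℤ) + 1) ^ 2)))))
          + ((∑ r' : Fin J, ∑ j : Fin J, (∑ l ∈ Finset.Ico B₃ B₄, (1 / ((l : ℝ) + 1) ^ (2 * (r' : ℕ) + 1)) * (((Complex.digamma (1 / 4 + ((freq a ((l : ℤ) + 1) : ℝ) : ℂ) / 2 * I)).im / 2 + (∑ k ∈ weilPrimeIndex a, (Λ k : ℝ) / Real.sqrt k * Real.sin (freq a ((l : ℤ) + 1) * Real.log k)) - archExpSumSin a ((l : ℤ) + 1)) / π / ((l : ℝ) + 1) ^ (2 * (j : ℕ) + 2)) / w l) * ((-1 : ℝ) ^ ((k : ℕ) + 1) * (-((((k : ℕ) : ℝ) + 1) ^ (2 * (r' : ℕ))) * ((Complex.digamma (1 / 4 + ((freq a (((k : ℕ) : ℤ) + 1) : ℝ) : ℂ) / 2 * I)).im / 2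 + (∑ p ∈ weilPrimeIndex a, (Λ p : ℝ) / Real.sqrt p * Real.sin (freq a (((k : ℕ) : ℤ) + 1) * Real.log p)) - archExpSumSin a (((k : ℕ) : ℤ) + 1)) / π - 4 * (Real.exp (a / 2) - Real.exp (-(a / 2))) ^ 2 / π * (-1 : ℝ) ^ (r' : ℕ) * (a ^ 2 / (4 * π ^ 2)) ^ (r' : ℕ) * (freq a (((k : ℕ) : ℤ) + 1) / (1 + 4 * freq a (((k : ℕ) : ℤ) + 1) ^ 2)))) * ((-1 : ℝ) ^ ((k' : ℕ) + 1) * (((k' : ℕ) : ℝ) + 1) ^ (2 * (j : ℕ) + 1)))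
            + ∑ r' : Fin J, ∑ r'' : Fin J, (∑ l ∈ Finset.Ico B₃ B₄, (1 / ((l : ℝ) + 1) ^ (2 * (r' : ℕ) + 1)) * (1 / ((l : ℝ) + 1) ^ (2 * (r'' : ℕ) + 1)) / w l) * ((-1 : ℝ) ^ ((k : ℕ) + 1) * (-((((k : ℕ) : ℝ) + 1) ^ (2 * (r' : ℕ))) * ((Complex.digamma (1 / 4 + ((freq a (((k : ℕ) : ℤ) + 1) : ℝ) : ℂ) / 2 * I)).im / 2 + (∑ p ∈ weilPrimeIndex a, (Λ p : ℝ) / Real.sqrt p * Real.sin (freq a (((k : ℕ) : ℤ) + 1) * Real.log p)) - archExpSumSin a (((k : ℕ) : ℤ) + 1)) / π - 4 * (Real.exp (a / 2) - Real.exp (-(a / 2))) ^ 2 / π * (-1 : ℝ) ^ (r' : ℕ) * (a ^ 2 / (4 * π ^ 2)) ^ (r' : ℕ) * (freq a (((k : ℕ) : ℤ) + 1) / (1 + 4 * freq a (((k : ℕ) : ℤ) + 1) ^ 2)))) * ((-1 : ℝ) ^ ((k' : ℕ) + 1) * (-((((k' : ℕ) : ℝ) + 1) ^ (2 * (r'' :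 ℕ))) * ((Complex.digamma (1 / 4 + ((freq a (((k' : ℕ) : ℤ) + 1) : ℝ) : ℂ) / 2 * I)).im / 2 + (∑ p ∈ weilPrimeIndex a, (Λ p : ℝ) / Real.sqrt p * Real.sin (freq a (((k' : ℕ) : ℤ) + 1) * Real.log p)) - archExpSumSin a (((k' : ℕ) : ℤ) + 1)) / π - 4 * (Real.exp (a / 2) - Real.exp (-(a / 2))) ^ 2 / π * (-1 : ℝ) ^ (r'' : ℕ) * (a ^ 2 / (4 * π ^ 2)) ^ (r'' : ℕ) * (freq a (((k' : ℕ) : ℤ) + 1) / (1 + 4 * freq a (((k' : ℕ) : ℤ) + 1) ^ 2))))))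
        + (if k = k' then (1 + θ⁻¹) * (B : ℝ) * ((2 * (π / 4 + (∑ k ∈ weilPrimeIndex a, (Λ k : ℝ) / Real.sqrt k) + a * (1 + weilArchDensity (2 * a)) / π) * (((k : ℕ) : ℝ) + 1) ^ (2 * J) / π + 4 * (Real.exp (a / 2) - Real.exp (-(a / 2))) ^ 2 / π * (a ^ 2 / (4 * π ^ 2)) ^ J * (freq a (((k : ℕ) : ℤ) + 1) / (1 + 4 * freq a (((k : ℕ) : ℤ) + 1) ^ 2)))) ^ 2 * (∑ l ∈ Finset.Ico B₃ B₄, (1 / (((l : ℝ) + 1) ^ (2 * J + 1))) ^ 2 / w l) else 0)) *ᵥ x := by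
  -- abbreviations
  set T := Finset.Ico B₃ B₄ with hT
  have hB₃2 : 2 ≤ B₃ := by omega
  have hB0 : (0 : ℝ) < B := by exact_mod_cast hB
  set Fmode : ℤ → ℝ := fun n ↦ (Complex.digamma (1 / 4 + ((freq a n : ℝ) : ℂ) / 2 * I)).im / 2
      + (∑ k ∈ weilPrimeIndex a, (Λ k : ℝ) / Real.sqrt k * Real.sin (freq a n * Real.log k)) - archExpSumSin a n
    with hFmode
  set S2 : ℝ := (Real.exp (a / 2) - Real.exp (-(a / 2))) ^ 2 with hS2
  set q : ℝ := a ^ 2 / (4 * π ^ 2) with hq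
  set dfac : ℤ → ℝ := fun n ↦ freq a n / (1 + 4 * freq a n ^ 2) with hdfac
  -- row functionals (row k = mode k+1)
  set vA : Fin J → Fin B → ℝ := fun j k ↦ (-1 : ℝ) ^ ((k : ℕ) + 1) * (((k : ℕ) : ℝ) + 1) ^ (2 * (j : ℕ) + 1) with hvA
  set vB : Fin J → Fin B → ℝ := fun r k ↦ (-1 : ℝ) ^ ((k : ℕ) + 1) *
      (-((((k : ℕ) : ℝ) + 1) ^ (2 * (r : ℕ))) * Fmode (((k : ℕ) : ℤ) + 1) / π
        - 4 * S2 / π * (-1 : ℝ) ^ (r : ℕ) * q ^ (r : ℕ) * dfac (((k : ℕ) : ℤ) + 1)) with hvB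
  set αA : Fin J → ℝ := fun j ↦ ∑ k, vA j k * x k with hαA
  set αB : Fin J → ℝ := fun r ↦ ∑ k, vB r k * x k with hαB
  set ρ : Fin B → ℝ := fun k ↦ (2 * (π / 4 + (∑ k ∈ weilPrimeIndex a, (Λ k : ℝ) / Real.sqrt k)
        + a * (1 + weilArchDensity (2 * a)) / π) * (((k : ℕ) : ℝ) + 1) ^ (2 * J) / π
        + 4 * S2 / π * q ^ J * dfac (((k : ℕ) : ℤ) + 1)) with hρ
  set bcol : ℕ → Fin B → ℝ := fun l k ↦
    ((gramCoeff a (((k : ℕ) : ℤ) + 1) ((l : ℤ) + 1) - gramCoeff a (((k : ℕ) : ℤ) + 1) (-((l : ℤ) + 1))) / 2) with hbcol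
  -- per-mode facts
  have hTl : ∀ l ∈ T, B₃ ≤ l := fun l hl ↦ (Finset.mem_Ico.mp hl).1
  have key : ∀ l ∈ T, (∑ k, bcol l k * x k) ^ 2 / d l
      ≤ (1 + θ) * ((Fmode ((l : ℤ) + 1) / π * (∑ j, αA j / ((l : ℝ) + 1) ^ (2 * (j : ℕ) + 2)) + (∑ r, αB r / ((l : ℝ) + 1) ^ (2 * (r : ℕ) + 1))) ^ 2 / w l)
        + (1 + θ⁻¹) * (B : ℝ) * (∑ k, ρ k ^ 2 * x k ^ 2) * ((1 / (((l : ℝ) + 1) ^ (2 * J + 1))) ^ 2 / w l) := by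
    intro l hl
    have hlT := Finset.mem_Ico.mp hl
    have hlB := hlT.1
    have hl0 : (0 : ℝ) < (l : ℝ) + 1 := by positivity
    have hwl := hw l hlT.1 hlT.2
    have hwpos : 0 < w l := hwl.1
    have hdpos : 0 < d l := lt_of_lt_of_le hwpos hwl.2
    -- decomposition of the column sum (modes i = k+1, m = l+1)
    set R : ℝ := ∑ k, (bcol l k - (-1 : ℝ) ^ (l + 1) *
        (Fmode ((l : ℤ) + 1) / π * ∑ j ∈ Finset.range J,
            ((-1 : ℝ) ^ ((k : ℕ) + 1) * (((k : ℕ) : ℝ) + 1) ^ (2 * j + 1)) / ((l : ℝ) + 1) ^ (2 * j + 2)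
          + ∑ r ∈ Finset.range J, ((-1 : ℝ) ^ ((k : ℕ) + 1) *
              (-((((k : ℕ) : ℝ) + 1) ^ (2 * r)) * Fmode (((k : ℕ) : ℤ) + 1) / π
                - 4 * S2 / π * (-1 : ℝ) ^ r * q ^ r * dfac (((k : ℕ) : ℤ) + 1))) / ((l : ℝ) + 1) ^ (2 * r + 1)))
        * x k with hR
    have hsplit : ∑ k, bcol l k * x k = (-1 : ℝ) ^ (l + 1) *
        (Fmode ((l : ℤ) + 1) / π * (∑ j, αA j / ((l : ℝ) + 1) ^ (2 * (j : ℕ) + 2))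
          + (∑ r, αB r / ((l : ℝ) + 1) ^ (2 * (r : ℕ) + 1))) + R := by
      have ePA : (∑ j, αA j / ((l : ℝ) + 1) ^ (2 * (j : ℕ) + 2)) = ∑ k : Fin B, (∑ j ∈ Finset.range J,
          ((-1 : ℝ) ^ ((k : ℕ) + 1) * (((k : ℕ) : ℝ) + 1) ^ (2 * j + 1)) / ((l : ℝ) + 1) ^ (2 * j + 2)) * x k := by
        simp only [hαA, hvA, Finset.sum_div]
        rw [Finset.sum_comm]
        refine Finset.sum_congr rfl fun k _ ↦ ?_
        rw [Finset.sum_mul, Finset.sum_range]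
        refine Finset.sum_congr rfl fun j _ ↦ by ring
      have ePB : (∑ r, αB r / ((l : ℝ) + 1) ^ (2 * (r : ℕ) + 1)) = ∑ k : Fin B, (∑ r ∈ Finset.range J,
          ((-1 : ℝ) ^ ((k : ℕ) + 1) *
            (-((((k : ℕ) : ℝ) + 1) ^ (2 * r)) * Fmode (((k : ℕ) : ℤ) + 1) / π
              - 4 * S2 / π * (-1 : ℝ) ^ r * q ^ r * dfac (((k : ℕ) : ℤ) + 1))) / ((l : ℝ) + 1) ^ (2 * r + 1)) * x k := by
        simp only [hαB, hvB, Finset.sum_div]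
        rw [Finset.sum_comm]
        refine Finset.sum_congr rfl fun k _ ↦ ?_
        rw [Finset.sum_mul, Finset.sum_range]
        refine Finset.sum_congr rfl fun r _ ↦ by ring
      rw [ePA, ePB, hR, Finset.mul_sum, mul_add, Finset.mul_sum, Finset.mul_sum, ← Finset.sum_add_distrib,
        ← Finset.sum_add_distrib]
      refine Finset.sum_congr rfl fun k _ ↦ by ring
    -- the remainder bound per row, via the mode-level decomposition lemma
    have hrow : ∀ k : Fin B, abs (bcol l k - (-1 : ℝ) ^ (l + 1) *
        (Fmode ((l : ℤ) + 1) / π * ∑ j ∈ Finset.range J,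
            ((-1 : ℝ) ^ ((k : ℕ) + 1) * (((k : ℕ) : ℝ) + 1) ^ (2 * j + 1)) / ((l : ℝ) + 1) ^ (2 * j + 2)
          + ∑ r ∈ Finset.range J, ((-1 : ℝ) ^ ((k : ℕ) + 1) *
              (-((((k : ℕ) : ℝ) + 1) ^ (2 * r)) * Fmode (((k : ℕ) : ℤ) + 1) / π
                - 4 * S2 / π * (-1 : ℝ) ^ r * q ^ r * dfac (((k : ℕ) : ℤ) + 1))) / ((l : ℝ) + 1) ^ (2 * r + 1)))
        ≤ ρ k / ((l : ℝ) + 1) ^ (2 * J + 1) := by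
      intro k
      have him : 2 * ((k : ℕ) + 1) ≤ l + 1 := by have := k.isLt; omega
      have h := abs_oddKernel_col_sub_families_le ha (i := (k : ℕ) + 1) (m := l + 1) (by omega) him J
      simp only [hbcol, hFmode, hS2, hq, hdfac, hρ]
      push_cast at h ⊢
      exact h
    have hRsq : R ^ 2 ≤ (B : ℝ) * (∑ k, ρ k ^ 2 * x k ^ 2) * (1 / (((l : ℝ) + 1) ^ (2 * J + 1)) ^ 2) := by
      have h := sq_sum_mul_le_card_mul (ι := Fin B) _ (fun k ↦ ρ k / ((l : ℝ) + 1) ^ (2 * J + 1)) x hrow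
      simp only [Fintype.card_fin] at h
      refine h.trans (le_of_eq ?_)
      rw [mul_assoc, Finset.sum_mul]
      congr 1
      refine Finset.sum_congr rfl fun k _ ↦ ?_
      rw [div_pow]
      ring
    -- assemble: square, ONE Peter–Paul in θ, divide by w ≤ d
    have hsq : (∑ k, bcol l k * x k) ^ 2
        ≤ (1 + θ) * (Fmode ((l : ℤ) + 1) / π * (∑ j, αA j / ((l : ℝ) + 1) ^ (2 * (j : ℕ) + 2)) + (∑ r, αB r / ((l : ℝ) + 1) ^ (2 * (r : ℕ) + 1))) ^ 2
          + (1 + θ⁻¹) * ((B : ℝ) * (∑ k, ρ k ^ 2 * x k ^ 2) * (1 / (((l : ℝ) + 1) ^ (2 * J + 1)) ^ 2)) := by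
      rw [hsplit]
      have hpp := sq_add_le_peterPaul (p := (-1 : ℝ) ^ (l + 1) * (Fmode ((l : ℤ) + 1) / π * (∑ j, αA j / ((l : ℝ) + 1) ^ (2 * (j : ℕ) + 2)) + (∑ r, αB r / ((l : ℝ) + 1) ^ (2 * (r : ℕ) + 1)))) (q := R) hθ
      have hsgn : ((-1 : ℝ) ^ (l + 1) * (Fmode ((l : ℤ) + 1) / π * (∑ j, αA j / ((l : ℝ) + 1) ^ (2 * (j : ℕ) + 2)) + (∑ r, αB r / ((l : ℝ) + 1) ^ (2 * (r : ℕ) + 1)))) ^ 2 = (Fmode ((l : ℤ) + 1) / π * (∑ j, αA j / ((l : ℝ) + 1) ^ (2 * (j : ℕ) + 2)) + (∑ r, αB r / ((l : ℝ) + 1) ^ (2 * (r : ℕ) + 1))) ^ 2 := by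
        rw [mul_pow, ← pow_mul, Even.neg_one_pow (by exact ⟨l + 1, by ring⟩), one_mul]
      rw [hsgn] at hpp
      have h2 : 0 ≤ 1 + θ⁻¹ := by positivity
      exact hpp.trans (add_le_add le_rfl (mul_le_mul_of_nonneg_left hRsq h2))
    have hnn : 0 ≤ (∑ k, bcol l k * x k) ^ 2 := sq_nonneg _
    calc (∑ k, bcol l k * x k) ^ 2 / d l
        ≤ (∑ k, bcol l k * x k) ^ 2 / w l := div_le_div_of_nonneg_left hnn hwpos hwl.2
      _ ≤ ((1 + θ) * (Fmode ((l : ℤ) + 1) / π * (∑ j, αA j / ((l : ℝ) + 1) ^ (2 * (j : ℕ) + 2)) + (∑ r, αB r / ((l : ℝ) + 1) ^ (2 * (r : ℕ) + 1))) ^ 2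
          + (1 + θ⁻¹) * ((B : ℝ) * (∑ k, ρ k ^ 2 * x k ^ 2) * (1 / (((l : ℝ) + 1) ^ (2 * J + 1)) ^ 2))) / w l := div_le_div_of_nonneg_right hsq hwpos.le
      _ = _ := by
          field_simp
  -- sum over the middle range
  have step1 : ∑ l ∈ T, (∑ k, bcol l k * x k) ^ 2 / d l
      ≤ (1 + θ) * ∑ l ∈ T, (Fmode ((l : ℤ) + 1) / π * (∑ j, αA j / ((l : ℝ) + 1) ^ (2 * (j : ℕ) + 2)) + (∑ r, αB r / ((l : ℝ) + 1) ^ (2 * (r : ℕ) + 1))) ^ 2 / w l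
        + (1 + θ⁻¹) * (B : ℝ) * (∑ k, ρ k ^ 2 * x k ^ 2) * ∑ l ∈ T, (1 / (((l : ℝ) + 1) ^ (2 * J + 1))) ^ 2 / w l := by
    refine (Finset.sum_le_sum key).trans (le_of_eq ?_)
    simp only [Finset.sum_add_distrib, ← Finset.mul_sum]
  -- the structured sum, exactly, as four blocks
  have hpoly : ∀ l ∈ T, (Fmode ((l : ℤ) + 1) / π * (∑ j, αA j / ((l : ℝ) + 1) ^ (2 * (j : ℕ) + 2)) + (∑ r, αB r / ((l : ℝ) + 1) ^ (2 * (r : ℕ) + 1))) ^ 2 / w l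
      = ((∑ j, αA j * (Fmode ((l : ℤ) + 1) / π / ((l : ℝ) + 1) ^ (2 * (j : ℕ) + 2)))
          + ∑ r', αB r' * (1 / ((l : ℝ) + 1) ^ (2 * (r' : ℕ) + 1))) ^ 2 / w l := by
    intro l _
    rw [modePoly_eq_sum_mul]
  rw [Finset.sum_congr rfl hpoly, sum_sq_add_div_eq] at step1
  refine step1.trans (le_of_eq ?_)
  rw [dotProduct_mulVec_eq_sum_sum]
  simp only [Matrix.of_apply]
  rw [sum_sum_mul_skeletonMJ_eq, sum_sum_mul_gram2_eq, sum_sum_mul_gram2_eq, sum_sum_mul_gram2_eq, sum_sum_mul_gram2_eq]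

end Middle

end Summit.RiemannHypothesis.RiemannHypothesis.Theorems.WeilFormatC

end
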